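import Literature.AlgebraicGeometry.Resolution.HasseSchmidtLinearSubstitution
import Mathlib.RingTheory.MvPolynomial.WeightedHomogeneous
import Mathlib.RingTheory.MvPolynomial.Homogeneous
import Mathlib.LinearAlgebra.Matrix.Rank
import Mathlib.LinearAlgebra.Matrix.NonsingularInverse
import Mathlib.LinearAlgebra.Dimension.Constructions
import Mathlib.RingTheory.AlgebraicIndependent.Defs
import HarnessLib

/-!
# Powers of independent linear forms: algebraic independence and the Hilbert function

Topic: `Literature/AlgebraicGeometry/Resolution`. Let `K` be a field, `σ` a finite index type,
`c : Fin r → σ → K` linearly independent coefficient vectors, `ℓ_j = linearForm K (c j) = Σ_i c_{ji} x_i`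
the corresponding linear forms of `K[x] = MvPolynomial σ K`, and `q : Fin r → ℕ` positive exponents.
For the subalgebra `U = K[ℓ_1^{q_1}, …, ℓ_r^{q_r}]` — over a perfect field the shape of every graded
Hasse–Schmidt-stable subalgebra (`DiffStableSubalgebra.lean`), of the algebra of invariants of a
homogeneous additive group (Hironaka 1970), and of Hironaka's "edge algebras" — we prove:

* **`aeval_linearForm_pow_injective`** / **`algebraicIndependent_linearForm_pow`** — the powers
  `ℓ_j^{q_j}` are algebraically independent over `K`: the substitution
  `K[Y_1,…,Y_r] → K[x]`, `Y_j ↦ ℓ_j^{q_j}` is injective. Proof: a right inverse `B` of the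
  coefficient matrix (`exists_mul_eq_one_of_linearIndependent`, from `Matrix.rank`) gives an algebra
  map `ψ : K[x] → K[Y]` with `ψ(ℓ_j) = Y_j` (`exists_algHom_linearForm_eq_X`), and
  `Y_j ↦ Y_j^{q_j}` is injective (`aeval_X_pow_injective`, by the coefficient formula
  `coeff_scaleExp_aeval_X_pow`).
* **`homogeneousComponent_aeval_pow`** — the substitution intertwines the weighted grading
  (weights `q`) of `K[Y]` with the standard grading of `K[x]`.
* **`toSubmodule_range_inf_homogeneousSubmodule`** — hence the degree-`a` piece `U_a` is the image
  of the weighted-homogeneous piece `K[Y]_{(q), a}`, and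
* **`finrank_adjoin_linearForm_pow_inf_homogeneousSubmodule`** (and the primed version for linear
  forms given as elements of `span K {x_i}`) — the **Hilbert function**
  `dim_K U_a = #{m ∈ ℕ^r : Σ_j m_j q_j = a}` (`finrank_weightedHomogeneousSubmodule`: the
  weighted-homogeneous piece has the monomial basis).

All statements are [folklore] (standard commutative algebra); they are the link between the
structure theorem of `DiffStableSubalgebra.lean` and the lattice-point Hilbert functions `hilb` of
`Hironaka2017/EdgeHilbert.lean` (review-packet input (I3), STEPS A″.4).

## References

* H. Hironaka, *Additive groups associated with points of a projective space*, Ann. of Math. 92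
  (1970) 327–334. [Hironaka1970AdditiveGroups]
* J. Giraud, *Contact maximal en caractéristique positive*, Ann. Sci. ÉNS (4) 8 (1975) 201–234,
  §1.5–1.6. [Giraud1975]
-/

open MvPolynomial

namespace Literature.AlgebraicGeometry.Resolution

variable {σ : Type*} [Fintype σ] {K : Type*} [Field K] {r : ℕ}

section LinearForms

/-! ### Linear forms with independent coefficient vectors admit a retraction -/

/-- A linear form is homogeneous of degree `1`. [folklore] -/
theorem isHomogeneous_linearForm (v : σ → K) : (linearForm K v).IsHomogeneous 1 := by
  unfold linearForm
  refine IsHomogeneous.sum _ _ _ fun j _ => ?_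
  exact (isHomogeneous_X K j).C_mul (v j)

/-- `linearForm K v = Σ_i v_i • x_i`. [folklore] -/
theorem linearForm_eq_sum_smul (v : σ → K) : linearForm K v = ∑ i, v i • (X i : MvPolynomial σ K) := by
  simp [linearForm, smul_eq_C_mul]

/-- An element of the span of the variables is a linear form with some coefficient vector.
[folklore] -/
theorem exists_linearForm_eq_of_mem_span {f : MvPolynomial σ K}
    (hf : f ∈ Submodule.span K (Set.range (X : σ → MvPolynomial σ K))) :
    ∃ v : σ → K, linearForm K v = f := by
  obtain ⟨v, hv⟩ := (Submodule.mem_span_range_iff_exists_fun K).mp hf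
  exact ⟨v, by rw [linearForm_eq_sum_smul, hv]⟩

/-- Linear independence of linear forms is linear independence of their coefficient vectors.
[folklore] -/
theorem linearIndependent_of_linearIndependent_linearForm (c : Fin r → σ → K)
    (h : LinearIndependent K fun j => linearForm K (c j)) : LinearIndependent K c := by
  have hcomp : (fun j => linearForm K (c j)) =
      Fintype.linearCombination K (X : σ → MvPolynomial σ K) ∘ c := by
    funext j
    simp [Function.comp, Fintype.linearCombination_apply, linearForm_eq_sum_smul]
  rw [hcomp] at h
  exact LinearIndependent.of_comp _ h

/-- Linearly independent rows admit a right inverse matrix. [folklore] -/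
theorem exists_mul_eq_one_of_linearIndependent (c : Fin r → σ → K) (hc : LinearIndependent K c) :
    ∃ B : Matrix σ (Fin r) K, Matrix.of c * B = 1 := by
  rw [← Matrix.mulVec_surjective_iff_exists_right_inverse]
  have hrank : (Matrix.of c).rank = r := by
    rw [Matrix.rank_eq_finrank_span_row]
    change Module.finrank K (Submodule.span K (Set.range c)) = r
    rw [finrank_span_eq_card hc, Fintype.card_fin]
  have htop : LinearMap.range (Matrix.of c).mulVecLin = ⊤ := by
    apply Submodule.eq_top_of_finrank_eq
    unfold Matrix.rank at hrank
    rw [hrank, Module.finrank_fin_fun]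
  intro y
  obtain ⟨x, hx⟩ : y ∈ LinearMap.range (Matrix.of c).mulVecLin := htop ▸ Submodule.mem_top
  exact ⟨x, hx⟩

/-- **Retraction.** For linearly independent coefficient vectors `c_j` there is a `K`-algebra map
`ψ : K[x] → K[Y_1,…,Y_r]` with `ψ(Σ_i c_{ji} x_i) = Y_j`. [folklore] -/
theorem exists_algHom_linearForm_eq_X (c : Fin r → σ → K) (hc : LinearIndependent K c) :
    ∃ ψ : MvPolynomial σ K →ₐ[K] MvPolynomial (Fin r) K, ∀ j, ψ (linearForm K (c j)) = X j := by
  obtain ⟨B, hB⟩ := exists_mul_eq_one_of_linearIndependent c hc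
  refine ⟨aeval fun i => ∑ j, C (B i j) * X j, fun j => ?_⟩
  have hentry : ∀ j', ∑ i, c j i * B i j' = if j = j' then 1 else 0 := by
    intro j'
    have := congrArg (fun M => M j j') hB
    simpa [Matrix.mul_apply, Matrix.one_apply] using this
  calc aeval (fun i => ∑ j, C (B i j) * X j) (linearForm K (c j))
      = ∑ i, C (c j i) * ∑ j', C (B i j') * (X j' : MvPolynomial (Fin r) K) := by
        simp [linearForm, map_sum, map_mul, algebraMap_eq]
    _ = ∑ j', C (∑ i, c j i * B i j') * (X j' : MvPolynomial (Fin r) K) := by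
        simp_rw [Finset.mul_sum, ← mul_assoc, ← C_mul]
        rw [Finset.sum_comm]
        simp_rw [← Finset.sum_mul, ← map_sum]
    _ = X j := by
        simp_rw [hentry]
        simp [apply_ite C]

end LinearForms

section PowerMap

/-! ### `Y_j ↦ Y_j^{q_j}` is injective -/

/-- Scaling of exponent vectors: `(scaleExp q m)_j = m_j q_j`. [folklore] -/
noncomputable def scaleExp (q : Fin r → ℕ) (m : Fin r →₀ ℕ) : Fin r →₀ ℕ :=
  Finsupp.equivFunOnFinite.symm fun j => m j * q j

/-- Components of the scaled exponent vector. [folklore] -/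
@[simp] theorem scaleExp_apply (q : Fin r → ℕ) (m : Fin r →₀ ℕ) (j : Fin r) :
    scaleExp q m j = m j * q j := by
  simp [scaleExp]

/-- Exponent scaling by positive weights is injective. [folklore] -/
theorem scaleExp_injective {q : Fin r → ℕ} (hq : ∀ j, 0 < q j) : Function.Injective (scaleExp q) := by
  intro m m' h
  ext j
  have := congrArg (fun d => d j) h
  simp only [scaleExp_apply] at this
  exact Nat.eq_of_mul_eq_mul_right (hq j) this

/-- The weight of `m` for the weights `q` is the degree of the scaled exponent. [folklore] -/
theorem weight_eq_sum (q : Fin r → ℕ) (m : Fin r →₀ ℕ) :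
    Finsupp.weight q m = ∑ j, m j * q j := by
  rw [Finsupp.weight_apply, Finsupp.sum_fintype _ _ (fun j => by simp)]
  simp

/-- `Y^m ↦ Y^{scaleExp q m}` under `Y_j ↦ Y_j^{q_j}`. [folklore] -/
theorem aeval_X_pow_monomial (q : Fin r → ℕ) (m : Fin r →₀ ℕ) (a : K) :
    aeval (fun j => (X j : MvPolynomial (Fin r) K) ^ q j) (monomial m a) =
      monomial (scaleExp q m) a := by
  rw [aeval_monomial, monomial_eq, Finsupp.prod_fintype _ _ (fun j => pow_zero _),
    Finsupp.prod_fintype _ _ (fun j => pow_zero _), algebraMap_eq]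
  congr 1
  refine Finset.prod_congr rfl fun j _ => ?_
  rw [← pow_mul, scaleExp_apply, mul_comm]

/-- Coefficient formula for `Y_j ↦ Y_j^{q_j}`: the coefficient of `Y^{scaleExp q m}` in the image
of `F` is the coefficient of `Y^m` in `F`. [folklore] -/
theorem coeff_scaleExp_aeval_X_pow {q : Fin r → ℕ} (hq : ∀ j, 0 < q j)
    (F : MvPolynomial (Fin r) K) (m : Fin r →₀ ℕ) :
    coeff (scaleExp q m) (aeval (fun j => (X j : MvPolynomial (Fin r) K) ^ q j) F) = coeff m F := by
  induction F using MvPolynomial.induction_on' with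
  | monomial n a =>
    rw [aeval_X_pow_monomial, coeff_monomial, coeff_monomial]
    simp only [(scaleExp_injective hq).eq_iff]
  | add f g hf hg => simp only [map_add, coeff_add, hf, hg]

/-- `Y_j ↦ Y_j^{q_j}` (`q_j > 0`) is injective on `K[Y_1,…,Y_r]`. [folklore] -/
theorem aeval_X_pow_injective {q : Fin r → ℕ} (hq : ∀ j, 0 < q j) :
    Function.Injective (aeval (R := K) fun j => (X j : MvPolynomial (Fin r) K) ^ q j) := by
  intro F G h
  ext m
  rw [← coeff_scaleExp_aeval_X_pow hq F m, ← coeff_scaleExp_aeval_X_pow hq G m, h]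

end PowerMap

section Independence

/-! ### Algebraic independence of `ℓ_j^{q_j}` -/

/-- **Powers of independent linear forms are algebraically independent**: the substitution
`Y_j ↦ ℓ_j^{q_j}` is injective. [folklore] -/
theorem aeval_linearForm_pow_injective (c : Fin r → σ → K) (hc : LinearIndependent K c)
    (q : Fin r → ℕ) (hq : ∀ j, 0 < q j) :
    Function.Injective (aeval (R := K) fun j => linearForm K (c j) ^ q j) := by
  obtain ⟨ψ, hψ⟩ := exists_algHom_linearForm_eq_X c hc
  have hcomp : ψ.comp (aeval fun j => linearForm K (c j) ^ q j) =
      aeval fun j => (X j : MvPolynomial (Fin r) K) ^ q j := by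
    refine MvPolynomial.algHom_ext fun j => ?_
    simp [hψ]
  intro F G h
  apply aeval_X_pow_injective hq
  rw [← hcomp]
  simp only [AlgHom.comp_apply, h]

/-- The same, phrased as `AlgebraicIndependent`. [folklore] -/
theorem algebraicIndependent_linearForm_pow (c : Fin r → σ → K) (hc : LinearIndependent K c)
    (q : Fin r → ℕ) (hq : ∀ j, 0 < q j) :
    AlgebraicIndependent K fun j => linearForm K (c j) ^ q j :=
  aeval_linearForm_pow_injective c hc q hq

/-- Version for linear forms given as elements of `span K {x_i}`. [folklore] -/
theorem algebraicIndependent_pow_of_mem_span (ℓ : Fin r → MvPolynomial σ K)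
    (hℓ : ∀ j, ℓ j ∈ Submodule.span K (Set.range (X : σ → MvPolynomial σ K)))
    (hli : LinearIndependent K ℓ) (q : Fin r → ℕ) (hq : ∀ j, 0 < q j) :
    AlgebraicIndependent K fun j => ℓ j ^ q j := by
  choose c hc using fun j => exists_linearForm_eq_of_mem_span (hℓ j)
  have hℓc : ℓ = fun j => linearForm K (c j) := funext fun j => (hc j).symm
  subst hℓc
  exact algebraicIndependent_linearForm_pow c
    (linearIndependent_of_linearIndependent_linearForm c hli) q hq

end Independence

section Hilbert

/-! ### The graded pieces of `K[ℓ^{q}]` and their dimensions -/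

omit [Fintype σ] in
/-- The image of a monomial `Y^m` under `Y_j ↦ ℓ_j^{q_j}` is homogeneous of degree `Σ m_j q_j`.
[folklore] -/
theorem isHomogeneous_aeval_pow_monomial (ℓ : Fin r → MvPolynomial σ K)
    (hℓ : ∀ j, (ℓ j).IsHomogeneous 1) (q : Fin r → ℕ) (m : Fin r →₀ ℕ) (a : K) :
    (aeval (fun j => ℓ j ^ q j) (monomial m a)).IsHomogeneous (Finsupp.weight q m) := by
  rw [aeval_monomial, Finsupp.prod_fintype _ _ (fun j => pow_zero _), algebraMap_eq]
  have h : Finsupp.weight q m = 0 + ∑ j, 1 * q j * m j := by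
    rw [weight_eq_sum, zero_add]
    exact Finset.sum_congr rfl fun j _ => by ring
  rw [h]
  exact (isHomogeneous_C σ a).mul
    (IsHomogeneous.prod _ _ _ fun j _ => ((hℓ j).pow (q j)).pow (m j))

omit [Fintype σ] in
/-- **The substitution `Y_j ↦ ℓ_j^{q_j}` intertwines the gradings**: the degree-`a` component of the
image is the image of the weighted-degree-`a` component (weights `q`). [folklore] -/
theorem homogeneousComponent_aeval_pow (ℓ : Fin r → MvPolynomial σ K)
    (hℓ : ∀ j, (ℓ j).IsHomogeneous 1) (q : Fin r → ℕ) (a : ℕ) (F : MvPolynomial (Fin r) K) :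
    homogeneousComponent a (aeval (fun j => ℓ j ^ q j) F) =
      aeval (fun j => ℓ j ^ q j) (weightedHomogeneousComponent q a F) := by
  induction F using MvPolynomial.induction_on' with
  | monomial m c =>
    rw [homogeneousComponent_of_mem (isHomogeneous_aeval_pow_monomial ℓ hℓ q m c),
      weightedHomogeneousComponent_of_mem (isWeightedHomogeneous_monomial (R := K) q m c rfl)]
    split_ifs <;> simp
  | add F G hF hG => simp only [map_add, hF, hG]

omit [Fintype σ] in
/-- The degree-`a` piece of the range of `Y_j ↦ ℓ_j^{q_j}` is the image of the weighted-homogeneous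
piece of weighted degree `a`. [folklore] -/
theorem toSubmodule_range_inf_homogeneousSubmodule (ℓ : Fin r → MvPolynomial σ K)
    (hℓ : ∀ j, (ℓ j).IsHomogeneous 1) (q : Fin r → ℕ) (a : ℕ) :
    Subalgebra.toSubmodule (aeval (fun j => ℓ j ^ q j)).range ⊓ homogeneousSubmodule σ K a =
      (weightedHomogeneousSubmodule K q a).map
        (aeval (fun j => ℓ j ^ q j) : MvPolynomial (Fin r) K →ₐ[K] MvPolynomial σ K).toLinearMap := by
  ext u
  simp only [Submodule.mem_inf, Subalgebra.mem_toSubmodule, AlgHom.mem_range,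
    mem_homogeneousSubmodule, Submodule.mem_map, AlgHom.toLinearMap_apply,
    mem_weightedHomogeneousSubmodule]
  constructor
  · rintro ⟨⟨F, rfl⟩, hu⟩
    refine ⟨weightedHomogeneousComponent q a F,
      weightedHomogeneousComponent_isWeightedHomogeneous a F, ?_⟩
    rw [← homogeneousComponent_aeval_pow ℓ hℓ, homogeneousComponent_of_mem hu, if_pos rfl]
  · rintro ⟨F, hF, rfl⟩
    refine ⟨⟨F, rfl⟩, ?_⟩
    have hF' : F = weightedHomogeneousComponent q a F := by
      rw [weightedHomogeneousComponent_of_mem hF, if_pos rfl]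
    rw [hF', ← homogeneousComponent_aeval_pow ℓ hℓ]
    exact homogeneousComponent_isHomogeneous a _

/-- **Monomial basis count**: the weighted-homogeneous piece of weighted degree `a` of
`K[Y]` has dimension `#{d : weight d = a}`. [folklore] -/
theorem finrank_weightedHomogeneousSubmodule {τ : Type*} (w : τ → ℕ) (a : ℕ) :
    Module.finrank K (weightedHomogeneousSubmodule K w a) =
      Nat.card {d : τ →₀ ℕ // Finsupp.weight w d = a} := by
  have h : weightedHomogeneousSubmodule K w a = restrictSupport K {d | Finsupp.weight w d = a} :=
    weightedHomogeneousSubmodule_eq_finsupp_supported K w a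
  rw [h, Module.finrank_eq_nat_card_basis (basisRestrictSupport K _)]
  rfl

omit [Fintype σ] in
/-- **Hilbert function of `K[ℓ_1^{q_1},…,ℓ_r^{q_r}]`** for homogeneous linear `ℓ_j` such that the
`ℓ_j^{q_j}` are algebraically independent: `dim_K U_a = #{m ∈ ℕ^r : Σ m_j q_j = a}`. [folklore] -/
theorem finrank_range_inf_homogeneousSubmodule (ℓ : Fin r → MvPolynomial σ K)
    (hℓ : ∀ j, (ℓ j).IsHomogeneous 1) (q : Fin r → ℕ)
    (hinj : Function.Injective (aeval (R := K) fun j => ℓ j ^ q j)) (a : ℕ) :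
    Module.finrank K
        ↥(Subalgebra.toSubmodule (Algebra.adjoin K (Set.range fun j => ℓ j ^ q j)) ⊓
          homogeneousSubmodule σ K a) =
      Nat.card {d : Fin r →₀ ℕ // Finsupp.weight q d = a} := by
  rw [Algebra.adjoin_range_eq_range_aeval, toSubmodule_range_inf_homogeneousSubmodule ℓ hℓ q a,
    ← finrank_weightedHomogeneousSubmodule (K := K) q a]
  exact (LinearEquiv.finrank_eq (Submodule.equivMapOfInjective _ hinj _)).symm

/-- **Hilbert function of `K[ℓ_1^{q_1},…,ℓ_r^{q_r}]`** for independent linear forms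
`ℓ_j = Σ_i c_{ji} x_i` and positive exponents: `dim_K U_a = #{m ∈ ℕ^r : Σ m_j q_j = a}`.
[folklore] -/
theorem finrank_adjoin_linearForm_pow_inf_homogeneousSubmodule (c : Fin r → σ → K)
    (hc : LinearIndependent K c) (q : Fin r → ℕ) (hq : ∀ j, 0 < q j) (a : ℕ) :
    Module.finrank K
        ↥(Subalgebra.toSubmodule (Algebra.adjoin K (Set.range fun j => linearForm K (c j) ^ q j)) ⊓
          homogeneousSubmodule σ K a) =
      Nat.card {d : Fin r →₀ ℕ // Finsupp.weight q d = a} :=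
  finrank_range_inf_homogeneousSubmodule _ (fun j => isHomogeneous_linearForm (c j)) q
    (aeval_linearForm_pow_injective c hc q hq) a

/-- The same for linear forms given as elements of `span K {x_i}` (the output format of
`exists_eq_adjoin_pow_linearForms_of_isDiffStable`). [folklore] -/
theorem finrank_adjoin_pow_inf_homogeneousSubmodule_of_mem_span (ℓ : Fin r → MvPolynomial σ K)
    (hℓ : ∀ j, ℓ j ∈ Submodule.span K (Set.range (X : σ → MvPolynomial σ K)))
    (hli : LinearIndependent K ℓ) (q : Fin r → ℕ) (hq : ∀ j, 0 < q j) (a : ℕ) :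
    Module.finrank K
        ↥(Subalgebra.toSubmodule (Algebra.adjoin K (Set.range fun j => ℓ j ^ q j)) ⊓
          homogeneousSubmodule σ K a) =
      Nat.card {d : Fin r →₀ ℕ // Finsupp.weight q d = a} := by
  choose c hc using fun j => exists_linearForm_eq_of_mem_span (hℓ j)
  have hℓc : ℓ = fun j => linearForm K (c j) := funext fun j => (hc j).symm
  subst hℓc
  exact finrank_adjoin_linearForm_pow_inf_homogeneousSubmodule c
    (linearIndependent_of_linearIndependent_linearForm c hli) q hq a

end Hilbert

end Literature.AlgebraicGeometry.Resolution
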